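import Summits.AtomisticToContinuum.Crystallization.Theses.SpectralChargeLedger
import Summits.AtomisticToContinuum.Crystallization.Theorems.ReggeStarCoercivityStarCoercivityCoarseTierTransfer

/-!
# Route `SpectralChargeLedger`, crux `SummedShellPricing` (stmt-AtomisticToContinuum-17044),
# line `Sketch`: stub `stub_periodisation` — TRANSFER TORUS → FINITE (`1/3`-separated)

WHAT.  The torus form of K1 — one relaxed-Barlow cell `(a₀, h₀)` in the box and, for every
tolerance `τ ∈ (0,1]`, a price `κ > 0` with
`κ · #{q ∈ motif : q is τ-bad in P.points} ≤ #motif · (e(P) − e⋆)` for every periodic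
configuration `P` of `ℝ³` with `1/3`-separated point set (`e⋆ = ⨅_Q e(Q)`, τ-badness of a centre
`q` in a point set `S` = the open punctured `13/10·a₀`-shell of `q` in `S` is NOT τ-matched, after a
linear isometry and bijectively, to the 12-shell of `hcpStacking a₀ h₀` or of `fccStacking a₀ h₀`)
— implies the finite form with the SAME cell and the SAME `κ(τ)`: for every `1/3`-separated
`y : Fin N → ℝ³` and every finite set `B` of τ-bad indices (badness read in `Set.range y` with
centre `y i`), `κ · #B ≤ E_LJ(y) − N · e⋆`.

PROOF (periodisation; a port of `CoerciveTwoShellGapPeriodisation.stub_periodisation`, file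
`PhononSlackCertificatesCoerciveTwoShellGapPeriodisation.lean`, from the two-shell predicate to
K1's set-based first-shell predicate).  `N = 0`: `B = ∅` and `E_LJ = 0`.  For `N ≥ 1` the
configuration `y` is injective (`injective_of_separated`); take a periodic configuration `P` with
motif `univ.image y` all of whose non-zero periods have length `≥ 2Σ‖yᵢ‖ + 2`
(`CoarseTierTransfer.exists_periodicConfiguration`).  Then `P.points` is `1/3`-separated
(`separated_points`), `#motif = N`, `e(P) ≤ E_LJ(y)/N` (`energyPerParticle_le`), and — the only
new point — for every index `i` the open punctured `13/10·a₀`-shell of `y i` read in `P.points`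
EQUALS the shell read in `Set.range y` (`shell_eq`: `Set.range y ⊆ P.points`, and a point of `P`
within `13/10·a₀ ≤ 13/10 < 2` of `y i` is some `y j`, the other points being at distance `≥ 2`
by `two_le_dist_of_mem_points`).  Rewriting the goodness proposition along this set equality,
τ-badness of the index `i` is τ-badness of the motif point `y i`, so `#B ≤ #bad motif points`
(`B.image y ⊆ motif.filter bad`, `y` injective); feed `P` to the hypothesis:
`κ·#B ≤ κ·#bad ≤ N·(e(P) − e⋆) ≤ E_LJ(y) − N·e⋆` (`transfer_arith`).  No definition, no named
fact; all `[folklore]`.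
-/

noncomputable section

namespace Summit.AtomisticToContinuum.Crystallization.Theorems.SummedShellPricingPeriodisation

open scoped BigOperators Classical
open Literature.MathematicalPhysics.StatisticalMechanics Literature.Geometry.DiscreteGeometry
open Summit.AtomisticToContinuum.Crystallization.Theorems.CoarseTierTransfer

-- adapted from Summits/AtomisticToContinuum/Crystallization/Theorems/PhononSlackCertificatesCoerciveTwoShellGapPeriodisation.lean (stub_periodisation)

variable {N : ℕ} {x : Fin N → EuclideanSpace ℝ (Fin 3)} {P : PeriodicConfiguration 3}

/-- **Shells read in `P.points` are shells read in `Set.range x`.**  For a periodisation `P` of `x`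
(motif `univ.image x`, non-zero periods of length `≥ 2Σ‖xᵢ‖ + 2`) and a radius `r < 2`, the open
punctured `r`-shell of `x i` in `P.points` equals its open punctured `r`-shell in `Set.range x`:
motif points are points of `P`, and a point of `P` within `r < 2` of `x i` is some `x j`, the other
points of `P` being at distance `≥ 2` (`two_le_dist_of_mem_points`). [folklore] -/
theorem shell_eq (hPm : P.motif = Finset.univ.image x)
    (hPl : ∀ g ∈ P.lattice, g ≠ 0 → 2 * ∑ k, ‖x k‖ + 2 ≤ ‖g‖) (i : Fin N) {r : ℝ} (hr : r < 2) :
    {z : EuclideanSpace ℝ (Fin 3) | z ∈ P.points ∧ z ≠ x i ∧ dist z (x i) < r} =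
      {z : EuclideanSpace ℝ (Fin 3) | z ∈ Set.range x ∧ z ≠ x i ∧ dist z (x i) < r} := by
  ext z
  simp only [Set.mem_setOf_eq]
  constructor
  · rintro ⟨hzP, hne, hd⟩
    refine ⟨?_, hne, hd⟩
    by_contra hno
    have hfar : ∀ j, z ≠ x j := fun j hj => hno ⟨j, hj.symm⟩
    have h2 := two_le_dist_of_mem_points hPm hPl i hzP hfar
    rw [dist_comm] at hd
    linarith
  · rintro ⟨⟨j, rfl⟩, hne, hd⟩
    refine ⟨P.mem_points_of_mem_motif ?_, hne, hd⟩
    rw [hPm]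
    exact Finset.mem_image_of_mem x (Finset.mem_univ j)

/-- Arithmetic of the transfer: from `κ·C ≤ N·(e − e⋆)`, `e ≤ E/N` (`N > 0`), `B ≤ C` and `κ ≥ 0`
to `κ·B ≤ E − N·e⋆`. [folklore] -/
theorem transfer_arith {κ B C N e e' E : ℝ} (hκ : 0 ≤ κ) (hN : 0 < N)
    (key : κ * C ≤ N * (e - e')) (h2 : e ≤ E / N) (hBC : B ≤ C) : κ * B ≤ E - N * e' := by
  have h3 : e * N ≤ E := (le_div_iff₀ hN).1 h2
  have h4 : κ * B ≤ κ * C := mul_le_mul_of_nonneg_left hBC hκ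
  nlinarith

/-- **Stub `stub_periodisation` — transfer torus → finite** of line `Sketch` (crux
`SpectralChargeLedger.SummedShellPricing`, item 17044): torus K1 ⇒ finite K1 for `1/3`-separated
configurations, with the same cell `(a₀, h₀)` and the same price `κ(τ)`.  For `N ≥ 1` periodise `y`
by a lattice with non-zero periods of length `≥ 2Σ‖yᵢ‖ + 2`
(`CoarseTierTransfer.exists_periodicConfiguration`): the open `13/10·a₀`-shell of `y i` in
`P.points` equals its shell in `Set.range y` (`shell_eq`, `13/10·a₀ ≤ 13/10 < 2`), so τ-badness of
the index `i` is τ-badness of the motif point `y i` (rewrite along the set equality) and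
`#B ≤ #bad motif points`; `P.points` is `1/3`-separated (`separated_points`), `#motif = N`,
`e(P) ≤ E(y)/N` (`energyPerParticle_le`); conclude by `transfer_arith`.  `N = 0` is trivial.
[folklore] -/
theorem stub_periodisation :
    (∃ a₀ h₀ : ℝ, 47 / 50 ≤ a₀ ∧ a₀ ≤ 1 ∧ |h₀ - a₀ * Real.sqrt (2 / 3)| ≤ a₀ / 100 ∧
       ∀ τ : ℝ, 0 < τ → τ ≤ 1 → ∃ κ : ℝ, 0 < κ ∧
         ∀ P : PeriodicConfiguration 3, (∀ u ∈ P.points, ∀ v ∈ P.points, u ≠ v → (1 / 3 : ℝ) ≤ dist u v) →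
           κ * ((P.motif.filter fun q =>
               ¬ (∃ A : EuclideanSpace ℝ (Fin 3) →ₗᵢ[ℝ] EuclideanSpace ℝ (Fin 3),
                   (∃ e : ↥{z : EuclideanSpace ℝ (Fin 3) | z ∈ P.points ∧ z ≠ q ∧ dist z (q) < 13 / 10 * a₀} ≃
                       ↥{p : EuclideanSpace ℝ (Fin 3) | p ∈ hcpStacking a₀ h₀ ∧ p ≠ 0 ∧ ‖p‖ < 13 / 10 * a₀},
                     ∀ t : ↥{z : EuclideanSpace ℝ (Fin 3) | z ∈ P.points ∧ z ≠ q ∧ dist z (q) < 13 / 10 * a₀},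
                       dist ((t : EuclideanSpace ℝ (Fin 3)) - q)
                         (A ((e t : ↥{p : EuclideanSpace ℝ (Fin 3) | p ∈ hcpStacking a₀ h₀ ∧ p ≠ 0 ∧ ‖p‖ < 13 / 10 * a₀}) : EuclideanSpace ℝ (Fin 3))) ≤ τ) ∨
                   (∃ e : ↥{z : EuclideanSpace ℝ (Fin 3) | z ∈ P.points ∧ z ≠ q ∧ dist z (q) < 13 / 10 * a₀} ≃
                       ↥{p : EuclideanSpace ℝ (Fin 3) | p ∈ fccStacking a₀ h₀ ∧ p ≠ 0 ∧ ‖p‖ < 13 / 10 * a₀},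
                     ∀ t : ↥{z : EuclideanSpace ℝ (Fin 3) | z ∈ P.points ∧ z ≠ q ∧ dist z (q) < 13 / 10 * a₀},
                       dist ((t : EuclideanSpace ℝ (Fin 3)) - q)
                         (A ((e t : ↥{p : EuclideanSpace ℝ (Fin 3) | p ∈ fccStacking a₀ h₀ ∧ p ≠ 0 ∧ ‖p‖ < 13 / 10 * a₀}) : EuclideanSpace ℝ (Fin 3))) ≤ τ))).card : ℝ)
           ≤ (P.motif.card : ℝ) * (P.energyPerParticle lennardJones - (⨅ Q : PeriodicConfiguration 3, Q.energyPerParticle lennardJones))) →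
    ∃ a₀ h₀ : ℝ, 47 / 50 ≤ a₀ ∧ a₀ ≤ 1 ∧ |h₀ - a₀ * Real.sqrt (2 / 3)| ≤ a₀ / 100 ∧
      ∀ τ : ℝ, 0 < τ → τ ≤ 1 → ∃ κ : ℝ, 0 < κ ∧
        ∀ (N : ℕ) (y : Fin N → EuclideanSpace ℝ (Fin 3)), (∀ i j : Fin N, i ≠ j → (1 / 3 : ℝ) ≤ dist (y i) (y j)) →
          ∀ B : Finset (Fin N), (∀ i ∈ B,
            ¬ (∃ A : EuclideanSpace ℝ (Fin 3) →ₗᵢ[ℝ] EuclideanSpace ℝ (Fin 3),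
                (∃ e : ↥{z : EuclideanSpace ℝ (Fin 3) | z ∈ Set.range y ∧ z ≠ y i ∧ dist z (y i) < 13 / 10 * a₀} ≃
                    ↥{p : EuclideanSpace ℝ (Fin 3) | p ∈ hcpStacking a₀ h₀ ∧ p ≠ 0 ∧ ‖p‖ < 13 / 10 * a₀},
                  ∀ t : ↥{z : EuclideanSpace ℝ (Fin 3) | z ∈ Set.range y ∧ z ≠ y i ∧ dist z (y i) < 13 / 10 * a₀},
                    dist ((t : EuclideanSpace ℝ (Fin 3)) - y i)
                      (A ((e t : ↥{p : EuclideanSpace ℝ (Fin 3) | p ∈ hcpStacking a₀ h₀ ∧ p ≠ 0 ∧ ‖p‖ < 13 / 10 * a₀}) : EuclideanSpace ℝ (Fin 3))) ≤ τ) ∨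
                (∃ e : ↥{z : EuclideanSpace ℝ (Fin 3) | z ∈ Set.range y ∧ z ≠ y i ∧ dist z (y i) < 13 / 10 * a₀} ≃
                    ↥{p : EuclideanSpace ℝ (Fin 3) | p ∈ fccStacking a₀ h₀ ∧ p ≠ 0 ∧ ‖p‖ < 13 / 10 * a₀},
                  ∀ t : ↥{z : EuclideanSpace ℝ (Fin 3) | z ∈ Set.range y ∧ z ≠ y i ∧ dist z (y i) < 13 / 10 * a₀},
                    dist ((t : EuclideanSpace ℝ (Fin 3)) - y i)
                      (A ((e t : ↥{p : EuclideanSpace ℝ (Fin 3) | p ∈ fccStacking a₀ h₀ ∧ p ≠ 0 ∧ ‖p‖ < 13 / 10 * a₀}) : EuclideanSpace ℝ (Fin 3))) ≤ τ))) →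
          κ * (B.card : ℝ) ≤ interactionEnergy lennardJones y - (N : ℝ) * (⨅ Q : PeriodicConfiguration 3, Q.energyPerParticle lennardJones) := by
  rintro ⟨a₀, h₀, ha₁, ha₂, hh, hτ⟩
  refine ⟨a₀, h₀, ha₁, ha₂, hh, fun τ hτ₀ hτ₁ => ?_⟩
  obtain ⟨κ, hκ, hP⟩ := hτ τ hτ₀ hτ₁
  refine ⟨κ, hκ, fun N y hsep B hB => ?_⟩
  rcases Nat.eq_zero_or_pos N with rfl | hN
  · have hB0 : B = ∅ := Finset.eq_empty_of_isEmpty B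
    subst hB0
    simp [interactionEnergy]
  · have hx : Function.Injective y := injective_of_separated hsep
    obtain ⟨P, hPm, hPl⟩ := exists_periodicConfiguration y hN
    have key := hP P (separated_points hPm hPl hsep)
    have hcardm : (P.motif.card : ℝ) = N := by
      rw [hPm, Finset.card_image_of_injective _ hx]
      simp
    rw [hcardm] at key
    have h2 := energyPerParticle_le hPm hPl hx hN
    have hNr : (0 : ℝ) < N := by exact_mod_cast hN
    have hr : 13 / 10 * a₀ < 2 := by linarith
    refine transfer_arith hκ.le hNr key h2 ?_
    -- `#B ≤ #bad motif points`: `B.image y ⊆ motif.filter bad`, `y` injective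
    rw [← Finset.card_image_of_injective B hx]
    refine Nat.cast_le.2 (Finset.card_le_card (Finset.image_subset_iff.2 fun i hi =>
      Finset.mem_filter.2 ⟨?_, ?_⟩))
    · rw [hPm]
      exact Finset.mem_image_of_mem y (Finset.mem_univ i)
    · -- τ-badness of the index `i` is τ-badness of the motif point `y i`
      intro hgood
      rw [shell_eq hPm hPl i hr] at hgood
      exact hB i hi hgood

end Summit.AtomisticToContinuum.Crystallization.Theorems.SummedShellPricingPeriodisation

end
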